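import Summits.AnomalousDissipation.AnomalousDissipation.Theorems.SolenoidalFractalHomogenisationLagrangianStepFlatBilinearWindow
import Summits.AnomalousDissipation.AnomalousDissipation.Theorems.SolenoidalFractalHomogenisationLagrangianStepVmodFlatBlocks
import HarnessLib

/-!
# K1L_D (stmt-AnomalousDissipation-27980): (V_mod) flat stage, block (ss) — THE SLOW-VECTOR CLAUSE (V) READ UN-SQUARED AT THE PROPAGATOR LEVEL,
# in cell units, on single real mode pairs (row «C / coarse / P ≤ τ, y ≤ 1» of the certifier's table; tool T-V)
(helper; `--supports 27980 --as helper`; prover ad-sawtooth-k1loc-p1 g15; the cell-unit twin of lead-k1l-onelevel-p1 g4's chain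
`…CellTimeModewise` → `…FlatBilinearWindowCos` → `…PairData`, which is written for the physical objects of a `LagrangianLatticeCarrier`.)

Setting of `VmodFlat.SSMode_textE(H)`: `U` the propagator of the cell problem (carrier `cellField W M hM ν _ n`, tensor `(1/n²)•𝔸`), `T` the carrier-free
propagator with tensor `(1/n²)•(𝔸 + (c/ν)•Φ ν ((1/ν)•𝔸))`, both on `[0,Tw]`; a window start `s` at which the carrier is back at phase 0
(`cellField … (s + τ) = cellField … τ`, e.g. `s ∈ (M·W.period/ν)·ℕ`); a slow label `ℓ ≠ 0` inside (V)'s range `‖ℓ‖·⌈K/ν⌉ ≤ n` and inside a ball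
`freqBall L` with `2L < n`.  Then `SlowVectorClauseF` (V) gives, at EVERY window end `t ∈ [s, Tw]`:
* `ae_modeCoeff_sub_sq_le_cell` — (V) a.e. in the window time for the unit cosine datum (Lions solutions of both problems represented by `U`, `T`);
* `norm_fc_sub_cos_unit_le`, `norm_fc_sub_cos_le` — `‖𝓕((U−T)(s,t)x_c(p))(ℓ)‖ ≤ err_ℓ(t−s)·‖p‖` for cosine data `x_c(p) = toLp(Re(e_ℓ)•p)`, `p ⊥ ℓ`
  (weak continuity upgrade `le_on_Icc_of_ae_le_of_continuousOn₂`, scaling);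
* **`norm_fc_sub_le_of_clauseV`** — for every weakly divergence-free `v ∈ V2` supported on `{ℓ, −ℓ}`:
  `‖𝓕((U−T)(s,t)v)(ℓ)‖ ≤ 2√2·err_ℓ(t−s)·‖𝓕v(ℓ)‖`,
  `err_ℓ(τ) = C·(C·(ν^σ + (‖ℓ‖⌈K/ν⌉/n)^σ)·min 1 (R′τ) + R′·(M·W.period/ν))`, `R′ = 8π²‖ℓ‖²(hiΛ)(ν + c/ν)/n²` (the sine phase through the grid point
  `e_{i₀}/n`, `PropagatorSymm.map_translate_eq`, `PropagatorSymm.norm_fcoeff_sub_pair_le_of_cos`).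
`sorry`-free; NOT a proof of (ss), of the stub, of K1L_D or of AD; rung F-D1.A0.
-/

set_option linter.dupNamespace false

noncomputable section

namespace Summit.AnomalousDissipation.AnomalousDissipation.Theorems.SolenoidalFractalHomogenisation.LagrangianStep.VmodGen

open Set MeasureTheory Complex UnitAddTorus Filter
open scoped InnerProductSpace ENNReal
open Literature.Analysis Literature.Analysis.FunctionSpaces Literature.Analysis.FunctionSpaces.Torus
open Literature.Analysis.FluidPDE Literature.Analysis.FluidPDE.Torus Literature.Analysis.FluidPDE.LatticeShear
open Summit.AnomalousDissipation.AnomalousDissipation.Theorems.SolenoidalFractalHomogenisation.LagrangianStep.PropagatorSymm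
  (memLp_cosMode map_translate_eq norm_fcoeff_sub_pair_le_of_cos continuousOn_sum_norm_sq_modeCoeff_propagator_sub)
open Summit.AnomalousDissipation.AnomalousDissipation.Theorems.SolenoidalFractalHomogenisation.LagrangianStep.FlatWindow
  (sum_norm_sq_modeCoeff_coe integral_norm_sq_cosMode_le im_mFourier_grid_ne_zero exists_coord_of_ne_zero)
open Summit.AnomalousDissipation.AnomalousDissipation.Theorems.SolenoidalFractalHomogenisation.LagrangianStep.CellTime (modeCoeff_congr_ae)
open Summit.AnomalousDissipation.AnomalousDissipation.Theorems.SolenoidalFractalHomogenisation.RealisedQuasiStaticCellLaw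
  (isSmooth_cell isDivFree_cell memLp_top_stLift_cell isWeaklyDivFree_singleMode)
open Summit.AnomalousDissipation.AnomalousDissipation.Theorems.SolenoidalFractalHomogenisation.LagrangianStep.VmodFlat (fc fc_sub)
open Summit.AnomalousDissipation.AnomalousDissipation.Theorems.SolenoidalFractalHomogenisation.PermissibleCarrier (period_pos)

variable {k₀ : ℕ}

/-! ## §0 The error function of (V): `err_ℓ(τ) = C·(C·(ν^σ + (‖ℓ‖⌈K/ν⌉/n)^σ)·min 1 (R′τ) + R′·(M·W.period/ν))` -/

/-- The (V) error is non-negative (`C, hi, c ≥ 0`, `Λ ≥ 0`, `ν > 0`, `τ ≥ 0`, `M > 0`). -/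
theorem errV_nonneg (W : LatticeWord k₀) {M c hi Λ σ C K ν : ℝ} (hM : 0 < M) (hc : 0 ≤ c) (hhi : 0 ≤ hi) (hΛ : 0 ≤ Λ) (hC : 0 ≤ C)
    (hν : 0 < ν) (n : ℕ) (ℓ : Fin 3 → ℤ) {τ : ℝ} (hτ : 0 ≤ τ) :
    0 ≤ C * (C * (ν ^ σ + (‖Torus.latticeVec ℓ‖ * (⌈K / ν⌉₊ : ℝ) / n) ^ σ)
          * min 1 ((8 * Real.pi ^ 2 * ‖Torus.latticeVec ℓ‖ ^ 2 * (hi * Λ) * (ν + c / ν) / (n:ℝ) ^ 2) * τ)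
        + (8 * Real.pi ^ 2 * ‖Torus.latticeVec ℓ‖ ^ 2 * (hi * Λ) * (ν + c / ν) / (n:ℝ) ^ 2) * (M * W.period / ν)) := by
  have hP := period_pos W
  have hR : 0 ≤ 8 * Real.pi ^ 2 * ‖Torus.latticeVec ℓ‖ ^ 2 * (hi * Λ) * (ν + c / ν) / (n:ℝ) ^ 2 := by
    have : 0 ≤ ν + c / ν := by positivity
    positivity
  have hX : 0 ≤ ν ^ σ + (‖Torus.latticeVec ℓ‖ * (⌈K / ν⌉₊ : ℝ) / n) ^ σ := by positivity
  have hmin : 0 ≤ min 1 (8 * Real.pi ^ 2 * ‖Torus.latticeVec ℓ‖ ^ 2 * (hi * Λ) * (ν + c / ν) / (n:ℝ) ^ 2 * τ) :=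
    le_min zero_le_one (mul_nonneg hR hτ)
  have hPe : 0 ≤ M * W.period / ν := by positivity
  exact mul_nonneg hC (add_nonneg (mul_nonneg (mul_nonneg hC hX) hmin) (mul_nonneg hR hPe))

/-- The (V) error is continuous in the window length. -/
theorem continuous_errV (W : LatticeWord k₀) (M c hi Λ σ C K ν : ℝ) (n : ℕ) (ℓ : Fin 3 → ℤ) :
    Continuous fun τ : ℝ => C * (C * (ν ^ σ + (‖Torus.latticeVec ℓ‖ * (⌈K / ν⌉₊ : ℝ) / n) ^ σ)
          * min 1 ((8 * Real.pi ^ 2 * ‖Torus.latticeVec ℓ‖ ^ 2 * (hi * Λ) * (ν + c / ν) / (n:ℝ) ^ 2) * τ)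
        + (8 * Real.pi ^ 2 * ‖Torus.latticeVec ℓ‖ ^ 2 * (hi * Λ) * (ν + c / ν) / (n:ℝ) ^ 2) * (M * W.period / ν)) :=
  continuous_const.mul ((continuous_const.mul (continuous_const.min (continuous_const.mul continuous_id))).add continuous_const)

section Clause

variable {k : ℕ} {W : LatticeWord k} {M : ℝ} {hM : 0 < M} {c : ℝ}
  {Φ : ℝ → Visc4 (Fin 3) → Visc4 (Fin 3)} {lo hi Λ β σ C ν₀ K : ℝ}
  {ν : ℝ} {n : ℕ} {𝔸 : Visc4 (Fin 3)} {Tw : ℝ} {U T : ℝ → ℝ → (V2 →L[ℝ] V2)} {s : ℝ}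

/-! ## §1 (V) read on a window, a.e. in the window time, unit cosine datum -/

/-- **(V) on the window `[s, Tw]` of the flat pair, a.e., unit cosine datum** (cell units): for a.e. `t' ∈ (0, Tw − s)`,
`2Σᵢ|modeCoeff ℓ ((U−T)(s,s+t') x_c(p)) i|² ≤ err_ℓ(t')²·∫‖Re(e_ℓ)p‖²`. -/
theorem ae_modeCoeff_sub_sq_le_cell (hV : SlowVectorClauseF W M hM c Φ lo hi Λ β σ C ν₀ K) (hlo : 0 < lo) (hc : 0 ≤ c)
    (hν : ν ∈ Set.Ioo 0 ν₀) (hn : 1 ≤ n) (hodd : OddSmall 𝔸 (ν * β))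
    (hwin : ∃ lam ∈ Set.Icc (1:ℝ) Λ, NearIso 𝔸 (ν * (lo / lam)) (ν * (hi * lam)))
    (hΦw : ∃ lam ∈ Set.Icc (1:ℝ) Λ, NearIso (Φ ν ((1 / ν) • 𝔸)) (lo / lam) (hi * lam))
    (hU : IsPropagator Tw (cellField W M hM ν hν.1 n) ((1 / (n:ℝ) ^ 2) • 𝔸) U)
    (hT : IsPropagator Tw (fun (_ : ℝ) (_ : UnitAddTorus (Fin 3)) => (0 : EuclideanSpace ℝ (Fin 3)))
      ((1 / (n:ℝ) ^ 2) • (𝔸 + (c / ν) • Φ ν ((1 / ν) • 𝔸))) T)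
    (hs : 0 ≤ s) (hsT : s < Tw) (hphase : ∀ τ, cellField W M hM ν hν.1 n (s + τ) = cellField W M hM ν hν.1 n τ)
    {ℓ : Fin 3 → ℤ} (hℓ : ℓ ≠ 0) (hscale : ‖Torus.latticeVec ℓ‖ * (⌈K / ν⌉₊ : ℝ) ≤ n)
    {p : EuclideanSpace ℝ (Fin 3)} (hp : ‖p‖ = 1) (hpℓ : ⟪p, Torus.latticeVec ℓ⟫_ℝ = 0) :
    ∀ᵐ t' ∂(volume.restrict (Ioo 0 (Tw - s))),
      2 * ∑ i, ‖modeCoeff ℓ (⇑(U s (s + t') ((memLp_cosMode ℓ p).toLp _) - T s (s + t') ((memLp_cosMode ℓ p).toLp _))) i‖ ^ 2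
        ≤ (C * (C * (ν ^ σ + (‖Torus.latticeVec ℓ‖ * (⌈K / ν⌉₊ : ℝ) / n) ^ σ)
          * min 1 ((8 * Real.pi ^ 2 * ‖Torus.latticeVec ℓ‖ ^ 2 * (hi * Λ) * (ν + c / ν) / (n:ℝ) ^ 2) * t')
        + (8 * Real.pi ^ 2 * ‖Torus.latticeVec ℓ‖ ^ 2 * (hi * Λ) * (ν + c / ν) / (n:ℝ) ^ 2) * (M * W.period / ν))) ^ 2 * ∫ x, ‖(UnitAddTorus.mFourier ℓ x).re • p‖ ^ 2 := by
  set L : ℝ := Tw - s with hL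
  have hL0 : 0 < L := by rw [hL]; linarith
  have hn0 : (0:ℝ) < n := by exact_mod_cast (show 0 < n from hn)
  have hn2 : (0:ℝ) < 1 / (n:ℝ) ^ 2 := by positivity
  have hcν : 0 ≤ c / ν := div_nonneg hc hν.1.le
  -- windows of the two tensors
  obtain ⟨lam, hlam, hA⟩ := hwin
  obtain ⟨lam', hlam', hΦn⟩ := hΦw
  have hlam0 : 0 < lam := lt_of_lt_of_le one_pos hlam.1
  have hlam'0 : 0 < lam' := lt_of_lt_of_le one_pos hlam'.1
  have hcell : NearIso ((1 / (n:ℝ) ^ 2) • 𝔸) ((1 / (n:ℝ) ^ 2) * (ν * (lo / lam))) ((1 / (n:ℝ) ^ 2) * (ν * (hi * lam))) :=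
    hA.smul hn2.le
  have hcell_lo : 0 < (1 / (n:ℝ) ^ 2) * (ν * (lo / lam)) := mul_pos hn2 (mul_pos hν.1 (div_pos hlo hlam0))
  have hcoarse : NearIso ((1 / (n:ℝ) ^ 2) • (𝔸 + (c / ν) • Φ ν ((1 / ν) • 𝔸)))
      ((1 / (n:ℝ) ^ 2) * (ν * (lo / lam) + (c / ν) * (lo / lam'))) ((1 / (n:ℝ) ^ 2) * (ν * (hi * lam) + (c / ν) * (hi * lam'))) :=
    (hA.add (hΦn.smul hcν)).smul hn2.le
  have hcoarse_lo : 0 < (1 / (n:ℝ) ^ 2) * (ν * (lo / lam) + (c / ν) * (lo / lam')) := by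
    have h1 : 0 < ν * (lo / lam) := mul_pos hν.1 (div_pos hlo hlam0)
    have h2 : 0 ≤ (c / ν) * (lo / lam') := mul_nonneg hcν (div_pos hlo hlam'0).le
    exact mul_pos hn2 (by linarith)
  -- the datum
  set d : VF := fun x => (UnitAddTorus.mFourier ℓ x).re • p with hd_def
  have hddiv : FunctionSpaces.Torus.IsWeaklyDivFree d := isWeaklyDivFree_singleMode ℓ hpℓ
  -- Lions: the cell solution on `(0, L)` along the carrier, represented by `U` (the window start sees phase 0)
  have hbU : MemLp (FunctionSpaces.Torus.stLift (cellField W M hM ν hν.1 n)) ∞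
      (volume.restrict (Ioo 0 L ×ˢ (univ : Set (EuclideanSpace ℝ (Fin 3))))) := memLp_top_stLift_cell _ n L
  have hbUdiv : ∀ᵐ τ ∂(volume.restrict (Ioo (0:ℝ) L)), FunctionSpaces.Torus.IsWeaklyDivFree (cellField W M hM ν hν.1 n τ) :=
    ae_of_all _ fun τ => (isDivFree_cell _ n τ).isWeaklyDivFree_holds (isSmooth_cell _ n τ)
  obtain ⟨w, hw⟩ := Torus.exists_isWeakTensorPassiveVectorOn hL0 hcell hcell_lo hbU hbUdiv (memLp_cosMode ℓ p) hddiv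
  have hcar : (fun τ => cellField W M hM ν hν.1 n (s + τ)) = cellField W M hM ν hν.1 n := funext hphase
  have hwU := hU.repr s hs hsT d (memLp_cosMode ℓ p) hddiv w (by rw [hcar]; exact hw)
  -- Lions: the effective solution on the DOUBLE horizon `(0, 2L)` (as (V) asks), represented by `T` on `(0, L)`
  have hb0 : MemLp (FunctionSpaces.Torus.stLift (fun (_ : ℝ) (_ : UnitAddTorus (Fin 3)) => (0 : EuclideanSpace ℝ (Fin 3)))) ∞
      (volume.restrict (Ioo 0 (2 * L) ×ˢ (univ : Set (EuclideanSpace ℝ (Fin 3))))) := memLp_top_const 0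
  have hb0div : ∀ᵐ τ ∂(volume.restrict (Ioo (0:ℝ) (2 * L))),
      FunctionSpaces.Torus.IsWeaklyDivFree ((fun (_ : ℝ) (_ : UnitAddTorus (Fin 3)) => (0 : EuclideanSpace ℝ (Fin 3))) τ) :=
    ae_of_all _ fun τ θ hθ => by simp
  obtain ⟨v, hv⟩ := Torus.exists_isWeakTensorPassiveVectorOn (by linarith : 0 < 2 * L) hcoarse hcoarse_lo hb0 hb0div (memLp_cosMode ℓ p) hddiv
  have hv' : IsWeakTensorPassiveVectorOn 0 (Tw - s) ((1 / (n:ℝ) ^ 2) • (𝔸 + (c / ν) • Φ ν ((1 / ν) • 𝔸)))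
      (fun τ => (fun (_ : ℝ) (_ : UnitAddTorus (Fin 3)) => (0 : EuclideanSpace ℝ (Fin 3))) (s + τ)) d v :=
    WeakSol.mono_horizon hv (by rw [hL]; linarith)
  have hvT := hT.repr s hs hsT d (memLp_cosMode ℓ p) hddiv v hv'
  -- the clause on the horizon `L`
  have key := (hV ν hν n 𝔸 hodd ⟨lam, hlam, hA⟩ ℓ hℓ hscale p hp hpℓ L hL0).2 w v hw hv
  filter_upwards [key, hwU, hvT] with t' hkey hwt hvt
  obtain ⟨hmw, hew⟩ := hwt
  obtain ⟨hmv, hev⟩ := hvt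
  have hae : (⇑(U s (s + t') ((memLp_cosMode ℓ p).toLp d) - T s (s + t') ((memLp_cosMode ℓ p).toLp d)) : VF) =ᵐ[volume] fun x => w t' x - v t' x := by
    rw [← hew, ← hev]
    filter_upwards [Lp.coeFn_sub (hmw.toLp (w t')) (hmv.toLp (v t')), MemLp.coeFn_toLp hmw, MemLp.coeFn_toLp hmv] with x hx h1 h2
    rw [hx, Pi.sub_apply, h1, h2]
  have e : ∀ i, modeCoeff ℓ (⇑(U s (s + t') ((memLp_cosMode ℓ p).toLp d) - T s (s + t') ((memLp_cosMode ℓ p).toLp d))) i = modeCoeff ℓ (fun x => w t' x - v t' x) i :=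
    fun i => modeCoeff_congr_ae hae ℓ i
  have hsum : (∑ i, ‖modeCoeff ℓ (⇑(U s (s + t') ((memLp_cosMode ℓ p).toLp d) - T s (s + t') ((memLp_cosMode ℓ p).toLp d))) i‖ ^ 2)
      = ∑ i, ‖modeCoeff ℓ (fun x => w t' x - v t' x) i‖ ^ 2 := Finset.sum_congr rfl fun i _ => by rw [e i]
  rw [hsum]
  exact hkey

/-! ## §2 Every window end: the cosine bounds -/

/-- **Unit cosine datum, every window end `t ∈ [s, Tw]`**: `‖𝓕((U−T)(s,t) x_c(p))(ℓ)‖ ≤ err_ℓ(t − s)`. -/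
theorem norm_fc_sub_cos_unit_le (hV : SlowVectorClauseF W M hM c Φ lo hi Λ β σ C ν₀ K) (hlo : 0 < lo) (hhi : 0 ≤ hi) (hΛ : 1 ≤ Λ)
    (hc : 0 ≤ c) (hC : 0 ≤ C)
    (hν : ν ∈ Set.Ioo 0 ν₀) (hn : 1 ≤ n) (hodd : OddSmall 𝔸 (ν * β))
    (hwin : ∃ lam ∈ Set.Icc (1:ℝ) Λ, NearIso 𝔸 (ν * (lo / lam)) (ν * (hi * lam)))
    (hΦw : ∃ lam ∈ Set.Icc (1:ℝ) Λ, NearIso (Φ ν ((1 / ν) • 𝔸)) (lo / lam) (hi * lam))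
    (hU : IsPropagator Tw (cellField W M hM ν hν.1 n) ((1 / (n:ℝ) ^ 2) • 𝔸) U)
    (hT : IsPropagator Tw (fun (_ : ℝ) (_ : UnitAddTorus (Fin 3)) => (0 : EuclideanSpace ℝ (Fin 3)))
      ((1 / (n:ℝ) ^ 2) • (𝔸 + (c / ν) • Φ ν ((1 / ν) • 𝔸))) T)
    (hs : 0 ≤ s) (hsT : s < Tw) (hphase : ∀ τ, cellField W M hM ν hν.1 n (s + τ) = cellField W M hM ν hν.1 n τ)
    {t : ℝ} (hst : s ≤ t) (htT : t ≤ Tw)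
    {ℓ : Fin 3 → ℤ} (hℓ : ℓ ≠ 0) (hscale : ‖Torus.latticeVec ℓ‖ * (⌈K / ν⌉₊ : ℝ) ≤ n)
    {p : EuclideanSpace ℝ (Fin 3)} (hp : ‖p‖ = 1) (hpℓ : ⟪p, Torus.latticeVec ℓ⟫_ℝ = 0) :
    ‖fc (U s t ((memLp_cosMode ℓ p).toLp _) - T s t ((memLp_cosMode ℓ p).toLp _)) ℓ‖ ≤ (C * (C * (ν ^ σ + (‖Torus.latticeVec ℓ‖ * (⌈K / ν⌉₊ : ℝ) / n) ^ σ)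
          * min 1 ((8 * Real.pi ^ 2 * ‖Torus.latticeVec ℓ‖ ^ 2 * (hi * Λ) * (ν + c / ν) / (n:ℝ) ^ 2) * (t - s))
        + (8 * Real.pi ^ 2 * ‖Torus.latticeVec ℓ‖ ^ 2 * (hi * Λ) * (ν + c / ν) / (n:ℝ) ^ 2) * (M * W.period / ν))) := by
  set L : ℝ := Tw - s with hL
  have hL0 : 0 < L := by rw [hL]; linarith
  set xd : V2 := (memLp_cosMode ℓ p).toLp _ with hxd
  have hae := ae_modeCoeff_sub_sq_le_cell hV hlo hc hν hn hodd hwin hΦw hU hT hs hsT hphase hℓ hscale hp hpℓ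
  -- both sides are continuous in the window time on `[0, L]`
  have hmaps : MapsTo (fun t' : ℝ => s + t') (Icc 0 L) (Icc s Tw) := fun t' ht' => ⟨by linarith [ht'.1], by rw [hL] at ht'; linarith [ht'.2]⟩
  have hf : ContinuousOn (fun t' : ℝ => 2 * ∑ i, ‖modeCoeff ℓ ((U s (s + t') xd - T s (s + t') xd : V2) : VF) i‖ ^ 2) (Icc 0 L) :=
    (continuousOn_sum_norm_sq_modeCoeff_propagator_sub hU hT hs hsT.le xd ℓ).comp (continuous_const.add continuous_id).continuousOn hmaps
  have hg : ContinuousOn (fun t' : ℝ => (C * (C * (ν ^ σ + (‖Torus.latticeVec ℓ‖ * (⌈K / ν⌉₊ : ℝ) / n) ^ σ)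
          * min 1 ((8 * Real.pi ^ 2 * ‖Torus.latticeVec ℓ‖ ^ 2 * (hi * Λ) * (ν + c / ν) / (n:ℝ) ^ 2) * t')
        + (8 * Real.pi ^ 2 * ‖Torus.latticeVec ℓ‖ ^ 2 * (hi * Λ) * (ν + c / ν) / (n:ℝ) ^ 2) * (M * W.period / ν))) ^ 2 * ∫ x, ‖(UnitAddTorus.mFourier ℓ x).re • p‖ ^ 2) (Icc 0 L) :=
    (((continuous_errV W M c hi Λ σ C K ν n ℓ).pow 2).mul continuous_const).continuousOn
  have hall := FluidPDE.Torus.le_on_Icc_of_ae_le_of_continuousOn₂ hL0 hf hg hae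
  have ht0 : t - s ∈ Icc (0:ℝ) L := ⟨by linarith, by rw [hL]; linarith⟩
  have key := hall _ ht0
  have es : s + (t - s) = t := by ring
  simp only [es] at key
  rw [sum_norm_sq_modeCoeff_coe] at key
  have herr0 : 0 ≤ (C * (C * (ν ^ σ + (‖Torus.latticeVec ℓ‖ * (⌈K / ν⌉₊ : ℝ) / n) ^ σ)
          * min 1 ((8 * Real.pi ^ 2 * ‖Torus.latticeVec ℓ‖ ^ 2 * (hi * Λ) * (ν + c / ν) / (n:ℝ) ^ 2) * (t - s))
        + (8 * Real.pi ^ 2 * ‖Torus.latticeVec ℓ‖ ^ 2 * (hi * Λ) * (ν + c / ν) / (n:ℝ) ^ 2) * (M * W.period / ν))) :=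
    errV_nonneg W hM hc hhi (le_trans zero_le_one hΛ) hC hν.1 n ℓ (by linarith)
  have hint := integral_norm_sq_cosMode_le ℓ p
  rw [hp, one_pow] at hint
  have hsq : ‖mFourierCoeff (EuclideanSpace.complexify ∘ ⇑(U s t xd - T s t xd)) ℓ‖ ^ 2 ≤ ((C * (C * (ν ^ σ + (‖Torus.latticeVec ℓ‖ * (⌈K / ν⌉₊ : ℝ) / n) ^ σ)
          * min 1 ((8 * Real.pi ^ 2 * ‖Torus.latticeVec ℓ‖ ^ 2 * (hi * Λ) * (ν + c / ν) / (n:ℝ) ^ 2) * (t - s))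
        + (8 * Real.pi ^ 2 * ‖Torus.latticeVec ℓ‖ ^ 2 * (hi * Λ) * (ν + c / ν) / (n:ℝ) ^ 2) * (M * W.period / ν)))) ^ 2 := by
    have hmono := mul_le_mul_of_nonneg_left hint (sq_nonneg ((C * (C * (ν ^ σ + (‖Torus.latticeVec ℓ‖ * (⌈K / ν⌉₊ : ℝ) / n) ^ σ)
          * min 1 ((8 * Real.pi ^ 2 * ‖Torus.latticeVec ℓ‖ ^ 2 * (hi * Λ) * (ν + c / ν) / (n:ℝ) ^ 2) * (t - s))
        + (8 * Real.pi ^ 2 * ‖Torus.latticeVec ℓ‖ ^ 2 * (hi * Λ) * (ν + c / ν) / (n:ℝ) ^ 2) * (M * W.period / ν)))))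
    nlinarith [key, hmono, sq_nonneg ‖mFourierCoeff (EuclideanSpace.complexify ∘ ⇑(U s t xd - T s t xd)) ℓ‖]
  exact (pow_le_pow_iff_left₀ (norm_nonneg _) herr0 (by norm_num : (2:ℕ) ≠ 0)).1 hsq

/-- **Cosine data, any polarisation `p ⊥ ℓ`** (scaling): `‖𝓕((U−T)(s,t) x_c(p))(ℓ)‖ ≤ err_ℓ(t − s)·‖p‖`. -/
theorem norm_fc_sub_cos_le (hV : SlowVectorClauseF W M hM c Φ lo hi Λ β σ C ν₀ K) (hlo : 0 < lo) (hhi : 0 ≤ hi) (hΛ : 1 ≤ Λ)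
    (hc : 0 ≤ c) (hC : 0 ≤ C)
    (hν : ν ∈ Set.Ioo 0 ν₀) (hn : 1 ≤ n) (hodd : OddSmall 𝔸 (ν * β))
    (hwin : ∃ lam ∈ Set.Icc (1:ℝ) Λ, NearIso 𝔸 (ν * (lo / lam)) (ν * (hi * lam)))
    (hΦw : ∃ lam ∈ Set.Icc (1:ℝ) Λ, NearIso (Φ ν ((1 / ν) • 𝔸)) (lo / lam) (hi * lam))
    (hU : IsPropagator Tw (cellField W M hM ν hν.1 n) ((1 / (n:ℝ) ^ 2) • 𝔸) U)
    (hT : IsPropagator Tw (fun (_ : ℝ) (_ : UnitAddTorus (Fin 3)) => (0 : EuclideanSpace ℝ (Fin 3)))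
      ((1 / (n:ℝ) ^ 2) • (𝔸 + (c / ν) • Φ ν ((1 / ν) • 𝔸))) T)
    (hs : 0 ≤ s) (hsT : s < Tw) (hphase : ∀ τ, cellField W M hM ν hν.1 n (s + τ) = cellField W M hM ν hν.1 n τ)
    {t : ℝ} (hst : s ≤ t) (htT : t ≤ Tw)
    {ℓ : Fin 3 → ℤ} (hℓ : ℓ ≠ 0) (hscale : ‖Torus.latticeVec ℓ‖ * (⌈K / ν⌉₊ : ℝ) ≤ n)
    (p : EuclideanSpace ℝ (Fin 3)) (hpℓ : ⟪p, Torus.latticeVec ℓ⟫_ℝ = 0) :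
    ‖fc (U s t ((memLp_cosMode ℓ p).toLp _) - T s t ((memLp_cosMode ℓ p).toLp _)) ℓ‖ ≤ (C * (C * (ν ^ σ + (‖Torus.latticeVec ℓ‖ * (⌈K / ν⌉₊ : ℝ) / n) ^ σ)
          * min 1 ((8 * Real.pi ^ 2 * ‖Torus.latticeVec ℓ‖ ^ 2 * (hi * Λ) * (ν + c / ν) / (n:ℝ) ^ 2) * (t - s))
        + (8 * Real.pi ^ 2 * ‖Torus.latticeVec ℓ‖ ^ 2 * (hi * Λ) * (ν + c / ν) / (n:ℝ) ^ 2) * (M * W.period / ν))) * ‖p‖ := by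
  by_cases hp0 : p = 0
  · subst hp0
    have h0 : (memLp_cosMode ℓ (0 : EuclideanSpace ℝ (Fin 3))).toLp _ = (0 : V2) := by
      refine Lp.ext ((MemLp.coeFn_toLp _).trans ?_)
      filter_upwards [Lp.coeFn_zero (EuclideanSpace ℝ (Fin 3)) 2 volume] with x hx
      rw [hx, smul_zero]; rfl
    rw [h0, map_zero, map_zero, sub_zero, norm_zero, mul_zero]
    unfold fc; rw [fcoeff_zero, norm_zero]
  · have hnp : 0 < ‖p‖ := norm_pos_iff.2 hp0
    set u : EuclideanSpace ℝ (Fin 3) := (1 / ‖p‖) • p with hu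
    have hun : ‖u‖ = 1 := by rw [hu, norm_smul, Real.norm_eq_abs, abs_of_pos (by positivity)]; field_simp
    have huℓ : ⟪u, Torus.latticeVec ℓ⟫_ℝ = 0 := by rw [hu, real_inner_smul_left, hpℓ, mul_zero]
    have hxp : (memLp_cosMode ℓ p).toLp _ = ‖p‖ • (memLp_cosMode ℓ u).toLp _ := by
      rw [← MemLp.toLp_const_smul]
      refine MemLp.toLp_congr _ _ (Filter.Eventually.of_forall fun x => ?_)
      simp only [Pi.smul_apply, hu, smul_smul]
      rw [show ‖p‖ * ((UnitAddTorus.mFourier ℓ x).re * (1 / ‖p‖)) = (UnitAddTorus.mFourier ℓ x).re by field_simp]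
    rw [hxp, map_smul, map_smul, ← smul_sub]
    unfold fc
    rw [fcoeff_smul, norm_smul, Complex.norm_real, Real.norm_eq_abs, abs_of_pos hnp, mul_comm]
    exact mul_le_mul_of_nonneg_right
      (norm_fc_sub_cos_unit_le hV hlo hhi hΛ hc hC hν hn hodd hwin hΦw hU hT hs hsT hphase hst htT hℓ hscale hun huℓ) hnp.le

/-! ## §3 Pair data: the sine phase through a grid point -/

/-- **(V) UN-SQUARED ON SINGLE REAL MODE PAIRS, at the propagator level.**  See the module docstring: for every weakly divergence-free `v ∈ V2`
supported on `{ℓ, −ℓ}` (`ℓ ≠ 0`, `ℓ ∈ freqBall L`, `2L < n`, `‖ℓ‖⌈K/ν⌉ ≤ n`) and every window `[s,t] ⊆ [0,Tw]` whose start sees the carrier at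
phase 0, `‖𝓕((U−T)(s,t)v)(ℓ)‖ ≤ 2√2·err_ℓ(t−s)·‖𝓕v(ℓ)‖`. -/
theorem norm_fc_sub_le_of_clauseV (hV : SlowVectorClauseF W M hM c Φ lo hi Λ β σ C ν₀ K) (hlo : 0 < lo) (hhi : 0 ≤ hi) (hΛ : 1 ≤ Λ)
    (hc : 0 ≤ c) (hC : 0 ≤ C)
    (hν : ν ∈ Set.Ioo 0 ν₀) (hn : 1 ≤ n) (hodd : OddSmall 𝔸 (ν * β))
    (hwin : ∃ lam ∈ Set.Icc (1:ℝ) Λ, NearIso 𝔸 (ν * (lo / lam)) (ν * (hi * lam)))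
    (hΦw : ∃ lam ∈ Set.Icc (1:ℝ) Λ, NearIso (Φ ν ((1 / ν) • 𝔸)) (lo / lam) (hi * lam))
    (hU : IsPropagator Tw (cellField W M hM ν hν.1 n) ((1 / (n:ℝ) ^ 2) • 𝔸) U)
    (hT : IsPropagator Tw (fun (_ : ℝ) (_ : UnitAddTorus (Fin 3)) => (0 : EuclideanSpace ℝ (Fin 3)))
      ((1 / (n:ℝ) ^ 2) • (𝔸 + (c / ν) • Φ ν ((1 / ν) • 𝔸))) T)
    (hs : 0 ≤ s) (hsT : s < Tw) (hphase : ∀ τ, cellField W M hM ν hν.1 n (s + τ) = cellField W M hM ν hν.1 n τ)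
    {t : ℝ} (hst : s ≤ t) (htT : t ≤ Tw)
    {Lb : ℕ} (hLb : 2 * Lb < n) {ℓ : Fin 3 → ℤ} (hℓ : ℓ ≠ 0) (hℓL : ℓ ∈ Torus.freqBall (d := Fin 3) Lb)
    (hscale : ‖Torus.latticeVec ℓ‖ * (⌈K / ν⌉₊ : ℝ) ≤ n)
    (v : V2) (hv : v ∈ divFreeL2 (Fin 3)) (hvs : ∀ k', k' ≠ ℓ → k' ≠ -ℓ → fc v k' = 0) :
    ‖fc (U s t v - T s t v) ℓ‖ ≤ 2 * Real.sqrt 2 * (C * (C * (ν ^ σ + (‖Torus.latticeVec ℓ‖ * (⌈K / ν⌉₊ : ℝ) / n) ^ σ)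
          * min 1 ((8 * Real.pi ^ 2 * ‖Torus.latticeVec ℓ‖ ^ 2 * (hi * Λ) * (ν + c / ν) / (n:ℝ) ^ 2) * (t - s))
        + (8 * Real.pi ^ 2 * ‖Torus.latticeVec ℓ‖ ^ 2 * (hi * Λ) * (ν + c / ν) / (n:ℝ) ^ 2) * (M * W.period / ν))) * ‖fc v ℓ‖ := by
  have hnpos : 0 < n := hn
  have hn0 : (0:ℝ) < n := by exact_mod_cast hnpos
  have hn2 : (0:ℝ) < 1 / (n:ℝ) ^ 2 := by positivity
  have hcν : 0 ≤ c / ν := div_nonneg hc hν.1.le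
  -- windows (for the translation lemma)
  obtain ⟨lam, hlam, hA⟩ := hwin
  obtain ⟨lam', hlam', hΦn⟩ := hΦw
  have hlam0 : 0 < lam := lt_of_lt_of_le one_pos hlam.1
  have hlam'0 : 0 < lam' := lt_of_lt_of_le one_pos hlam'.1
  have hcell : NearIso ((1 / (n:ℝ) ^ 2) • 𝔸) ((1 / (n:ℝ) ^ 2) * (ν * (lo / lam))) ((1 / (n:ℝ) ^ 2) * (ν * (hi * lam))) :=
    hA.smul hn2.le
  have hcell_lo : 0 < (1 / (n:ℝ) ^ 2) * (ν * (lo / lam)) := mul_pos hn2 (mul_pos hν.1 (div_pos hlo hlam0))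
  have hcoarse : NearIso ((1 / (n:ℝ) ^ 2) • (𝔸 + (c / ν) • Φ ν ((1 / ν) • 𝔸)))
      ((1 / (n:ℝ) ^ 2) * (ν * (lo / lam) + (c / ν) * (lo / lam'))) ((1 / (n:ℝ) ^ 2) * (ν * (hi * lam) + (c / ν) * (hi * lam'))) :=
    (hA.add (hΦn.smul hcν)).smul hn2.le
  have hcoarse_lo : 0 < (1 / (n:ℝ) ^ 2) * (ν * (lo / lam) + (c / ν) * (lo / lam')) := by
    have h1 : 0 < ν * (lo / lam) := mul_pos hν.1 (div_pos hlo hlam0)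
    have h2 : 0 ≤ (c / ν) * (lo / lam') := mul_nonneg hcν (div_pos hlo hlam'0).le
    exact mul_pos hn2 (by linarith)
  -- carriers on the full horizon: boundedness, divergence-freeness, grid invariance
  have hbU : MemLp (FunctionSpaces.Torus.stLift (cellField W M hM ν hν.1 n)) ∞
      (volume.restrict (Ioo 0 Tw ×ˢ (univ : Set (EuclideanSpace ℝ (Fin 3))))) := memLp_top_stLift_cell _ n Tw
  have hbUdiv : ∀ᵐ τ ∂(volume.restrict (Ioo (0:ℝ) Tw)), FunctionSpaces.Torus.IsWeaklyDivFree (cellField W M hM ν hν.1 n τ) :=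
    ae_of_all _ fun τ => (isDivFree_cell _ n τ).isWeaklyDivFree_holds (isSmooth_cell _ n τ)
  have hb0 : MemLp (FunctionSpaces.Torus.stLift (fun (_ : ℝ) (_ : UnitAddTorus (Fin 3)) => (0 : EuclideanSpace ℝ (Fin 3)))) ∞
      (volume.restrict (Ioo 0 Tw ×ˢ (univ : Set (EuclideanSpace ℝ (Fin 3))))) := memLp_top_const 0
  have hb0div : ∀ᵐ τ ∂(volume.restrict (Ioo (0:ℝ) Tw)),
      FunctionSpaces.Torus.IsWeaklyDivFree ((fun (_ : ℝ) (_ : UnitAddTorus (Fin 3)) => (0 : EuclideanSpace ℝ (Fin 3))) τ) :=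
    ae_of_all _ fun τ θ hθ => by simp
  -- the grid point `e_{i₀}/n` with `Im e_ℓ ≠ 0`
  obtain ⟨i₀, hi₀, hsmall⟩ := exists_coord_of_ne_zero hLb hℓL hℓ
  set jj : Fin 3 → Fin n := fun i => if i = i₀ then ⟨1 % n, Nat.mod_lt _ hnpos⟩ else ⟨0, hnpos⟩ with hjj
  have hN1 : 1 < n := by have : (1:ℤ) ≤ |ℓ i₀| := Int.one_le_abs hi₀; omega
  have hjj0 : (jj i₀ : ℕ) = 1 := by simp [hjj, Nat.mod_eq_of_lt hN1]
  have hjj' : ∀ i, i ≠ i₀ → (jj i : ℕ) = 0 := fun i hi => by simp [hjj, hi]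
  have him := im_mFourier_grid_ne_zero hnpos hi₀ hsmall jj hjj0 hjj'
  have hgridU : ∀ (τ : ℝ) (z : UnitAddTorus (Fin 3)),
      cellField W M hM ν hν.1 n τ (z + (fun i => ((((jj i : ℕ) : ℝ) / n : ℝ) : UnitAddCircle))) = cellField W M hM ν hν.1 n τ z :=
    fun τ z => by unfold cellField; exact cell_add_grid _ hnpos jj τ z
  have hgrid0 : ∀ (τ : ℝ) (z : UnitAddTorus (Fin 3)),
      (fun (_ : ℝ) (_ : UnitAddTorus (Fin 3)) => (0 : EuclideanSpace ℝ (Fin 3))) τ (z + (fun i => ((((jj i : ℕ) : ℝ) / n : ℝ) : UnitAddCircle)))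
        = (fun (_ : ℝ) (_ : UnitAddTorus (Fin 3)) => (0 : EuclideanSpace ℝ (Fin 3))) τ z := fun _ _ => rfl
  have hUtr := fun z : V2 => map_translate_eq hU hcell hcell_lo hbU hbUdiv
    (fun i => ((((jj i : ℕ) : ℝ) / n : ℝ) : UnitAddCircle)) hgridU hs hst htT z
  have hTtr := fun z : V2 => map_translate_eq hT hcoarse hcoarse_lo hb0 hb0div
    (fun i => ((((jj i : ℕ) : ℝ) / n : ℝ) : UnitAddCircle)) hgrid0 hs hst htT z
  -- cosine bounds for every polarisation, then the pair lemma
  have herr0 : 0 ≤ (C * (C * (ν ^ σ + (‖Torus.latticeVec ℓ‖ * (⌈K / ν⌉₊ : ℝ) / n) ^ σ)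
          * min 1 ((8 * Real.pi ^ 2 * ‖Torus.latticeVec ℓ‖ ^ 2 * (hi * Λ) * (ν + c / ν) / (n:ℝ) ^ 2) * (t - s))
        + (8 * Real.pi ^ 2 * ‖Torus.latticeVec ℓ‖ ^ 2 * (hi * Λ) * (ν + c / ν) / (n:ℝ) ^ 2) * (M * W.period / ν))) :=
    errV_nonneg W hM hc hhi (le_trans zero_le_one hΛ) hC hν.1 n ℓ (by linarith)
  have hcos : ∀ p : EuclideanSpace ℝ (Fin 3), ⟪p, Torus.latticeVec ℓ⟫_ℝ = 0 →
      ‖mFourierCoeff (EuclideanSpace.complexify ∘ ⇑(U s t ((memLp_cosMode ℓ p).toLp _) - T s t ((memLp_cosMode ℓ p).toLp _))) ℓ‖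
        ≤ (C * (C * (ν ^ σ + (‖Torus.latticeVec ℓ‖ * (⌈K / ν⌉₊ : ℝ) / n) ^ σ)
          * min 1 ((8 * Real.pi ^ 2 * ‖Torus.latticeVec ℓ‖ ^ 2 * (hi * Λ) * (ν + c / ν) / (n:ℝ) ^ 2) * (t - s))
        + (8 * Real.pi ^ 2 * ‖Torus.latticeVec ℓ‖ ^ 2 * (hi * Λ) * (ν + c / ν) / (n:ℝ) ^ 2) * (M * W.period / ν))) * ‖p‖ :=
    fun p hpℓ => norm_fc_sub_cos_le hV hlo hhi hΛ hc hC hν hn hodd ⟨lam, hlam, hA⟩ ⟨lam', hlam', hΦn⟩ hU hT hs hsT hphase hst htT hℓ hscale p hpℓ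
  have key := norm_fcoeff_sub_pair_le_of_cos (U s t) (T s t) _ hUtr hTtr hℓ him herr0 hcos v hv hvs
  unfold fc
  simpa only [mul_assoc] using key

end Clause

end Summit.AnomalousDissipation.AnomalousDissipation.Theorems.SolenoidalFractalHomogenisation.LagrangianStep.VmodGen

end
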